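import Summits.BirchSwinnertonDyer.BirchSwinnertonDyer.Theorems.GenusKolyvaginAtTwoGenusPrimitiveSupplyAtTwoPrimeHeegnerTwin
import HarnessLib

/-!
# Route `GenusKolyvaginAtTwo`, crux `GenusPrimitiveSupplyAtTwo` (stmt-BirchSwinnertonDyer-22136):
# DEF = 1 Heegner twins on `Δ < 0` — composite `d_K`, and the Mazur–Rubin `V_T` dichotomy at the transposition prime

Seat `bsd-line-gk2-p5` g6 (cell `bsd-f1-sign2`), SUPPLY lineage; fourth file of the g6 series (`…LocalTwoTorsion`,
`…PrimeHeegnerTwin`, `…PrimeHeegnerTwinStubA`). Summit-side THEOREM-ONLY file (no definition, no named fact, no `sorry`),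
`--supports stmt-BirchSwinnertonDyer-22136`, route-independent imports.

* §1 The Mazur–Rubin SPLITTING LIST of Prop. 3.3 / Cor. 3.4 for a Heegner field on `Δ_W < 0`, once and for all
  (`mr_splitting_list`): additive and multiplicative primes divide `N_W`, hence split in `K` and are prime to `d_K`; the real
  place carries no condition; plus `√d_K ∈ K` and `d_K` square-free `≠ 1` (`discr_squarefree_of_odd`, `exists_sq_eq_discr`).
* §2 **General DEF = 1 on `Δ < 0`** (composite `d_K` allowed): ONE transposition prime `q₀ ∣ d_K`, every other prime of `d_K`
  silent, `2` split ⟹ (mod `MazurRubin2010.prop33_rat`) `#Sel₂(Wd) ∣ 2·#Sel₂(W)`, `#Sel₂(W) ∣ 2·#Sel₂(Wd)`, product non-square;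
  hence `#Sel₂(W) = 1 ⟹ #Sel₂(Wd) = 2` and `#Sel₂(Wd) = 2 ⟹ #Sel₂(W) ∈ {1, 4}` for EVERY DEF = 1 admissible field, not only the
  prime ones (`selmer_twin_DEF_one`, `natCard_selmerGroup_twin_eq_two_of_DEF_one`, `natCard_selmerGroup_eq_one_or_four_of_DEF_one`).
* §3 **The `V_T` dichotomy at the prime of a prime Heegner field** (mod the named fact `MazurRubin2010.cor34i_singleton_rat`,
  Cor. 3.4 (i) WITH its `V_T` clause): `Sel₂(W)` strict at `ℓ` ⟹ `#Sel₂(Wd) = 2·#Sel₂(W)` (rank UP), not strict ⟹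
  `#Sel₂(W) = 2·#Sel₂(Wd)` (rank DOWN) (`cor34i_twin_prime_heegner`). Consequences: on `#Sel₂(W) = 1` the twin is minimal by
  this route too (`Sel₂(W) = 0` is strict everywhere; `natCard_selmerGroup_twin_eq_two_of_cor34i`); on the `#Sel₂(W) = 4` cells
  (`Ш(E)[2] ≅ (ℤ/2)²` on the habitat) **the prime Heegner twin is Sel₂-minimal iff `Sel₂(W)` is NOT strict at `ℓ`**
  (`natCard_selmerGroup_twin_eq_two_iff_not_strict`) — the DEF = 1 supply there is a ČEBOTAREV condition on `ℓ` (some class of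
  `Ш(E)[2]` locally non-trivial at `ℓ`), exactly Mazur–Rubin's twisting mechanism; not discharged here.

References: [MazurRubin2010] Def. 3.1, Prop. 3.3, Cor. 3.4 (i); [GrossLMS1991] §1. No item is closed by this file; BSD is not
proved by any of this.
-/

set_option linter.dupNamespace false -- tree convention: `Summit.BirchSwinnertonDyer.BirchSwinnertonDyer.Theorems` (summit = sub-problem)
set_option autoImplicit false

noncomputable section

open scoped Classical

open NumberField WeierstrassCurve Literature.NumberTheory.EllipticCurves Literature.NumberTheory.QuadraticFields

namespace Summit.BirchSwinnertonDyer.BirchSwinnertonDyer.Theorems.GenusKolyTwin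

variable (W : WeierstrassCurve ℚ) [W.IsElliptic] [W.IsGloballyMinimal] {K : Type} [Field K] [NumberField K]

/-! ## §1. The splitting list of Mazur–Rubin Prop. 3.3 for a Heegner field on `Δ < 0` -/

omit [W.IsElliptic] [W.IsGloballyMinimal] in
/-- An odd discriminant of an imaginary quadratic field is square-free and `≠ 1`. [folklore] -/
theorem discr_squarefree_of_odd (hK : IsImaginaryQuadratic K) (hodd : Odd (discr K)) :
    Squarefree (discr K) ∧ discr K ≠ 1 := by
  have hneg : discr K < 0 := IsImaginaryQuadratic.discr_neg hK
  refine ⟨?_, by omega⟩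
  rcases Quadratic.isFundamentalDiscriminant_discr (K := K) hK.1 with h | h
  · exact h.2.1
  · exfalso
    obtain ⟨e, he⟩ := h.1
    exact (Int.not_even_iff_odd.mpr hodd) ⟨2 * e, by rw [he]; ring⟩

omit [W.IsElliptic] [W.IsGloballyMinimal] in
/-- `√d_K ∈ K` for a quadratic field `K`, in the binder shape of the Mazur–Rubin named facts. [folklore] -/
theorem exists_sq_eq_discr (h2 : Module.finrank ℚ K = 2) : ∃ x : K, x ^ 2 = ((discr K : ℤ) : K) := by
  obtain ⟨δ, -, hδ⟩ := Quadratic.exists_not_mem_range_sq_eq_discr (K := K) h2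
  exact ⟨δ, by rw [hδ, map_intCast]⟩

omit [W.IsGloballyMinimal] in
/-- **The splitting list of Mazur–Rubin 2010 Prop. 3.3 (K = ℚ, F = a Heegner field) on `Δ_W < 0`.** For `W/ℚ` elliptic with
`Δ_W < 0` and `K` quadratic satisfying the Heegner hypothesis for `N_W`: every prime of additive reduction splits in `K`; every
multiplicative prime (of either discriminant parity) splits in `K` and does not divide `d_K`; and the real-place clause
`0 < Δ_W → K totally real` holds vacuously. (Bad primes divide `N_W`, `dvd_conductorNorm_iff_not_hasGoodReductionAtPrime`;
split primes are unramified.) [cite: MazurRubin2010, Prop. 3.3 (hypotheses)] [cite: GrossLMS1991, §1 (p. 235)] -/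
theorem mr_splitting_list (hΔ : W.Δ < 0) (h2 : Module.finrank ℚ K = 2)
    (hH : SatisfiesHeegnerHypothesis (W.conductorNorm ℤ) K) :
    (∀ (p : ℕ) [Fact p.Prime], ¬ W.HasGoodReductionAtPrime p → ¬ W.HasMultiplicativeReductionAtPrime p →
        ((Ideal.span {(p : ℤ)}).primesOver (𝓞 K)).ncard = 2) ∧
    (∀ (p : ℕ) [Fact p.Prime], W.HasMultiplicativeReductionAtPrime p → Even (padicValRat p W.Δ) →
        ((Ideal.span {(p : ℤ)}).primesOver (𝓞 K)).ncard = 2) ∧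
    (0 < W.Δ → NumberField.IsTotallyReal K) ∧
    (∀ (p : ℕ) [Fact p.Prime], W.HasMultiplicativeReductionAtPrime p → Odd (padicValRat p W.Δ) →
        ¬ (p : ℤ) ∣ discr K) := by
  have hbad : ∀ (p : ℕ) [Fact p.Prime], ¬ W.HasGoodReductionAtPrime p →
      ((Ideal.span {(p : ℤ)}).primesOver (𝓞 K)).ncard = 2 ∧ ¬ (p : ℤ) ∣ discr K := by
    intro p _ hgood
    have hpN : p ∣ W.conductorNorm ℤ := (W.dvd_conductorNorm_iff_not_hasGoodReductionAtPrime p).mpr hgood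
    exact ⟨hH p Fact.out hpN, fun hpd => Literature.SatisfiesHeegnerHypothesis.not_dvd_discr h2 hH Fact.out hpN hpd⟩
  have hmult : ∀ (p : ℕ) [Fact p.Prime], W.HasMultiplicativeReductionAtPrime p → ¬ W.HasGoodReductionAtPrime p :=
    fun p _ h => WeierstrassCurve.HasMultiplicativeReduction.not_hasGoodReduction (R := ℤ_[p]) h
  exact ⟨fun p _ hgood _ => (hbad p hgood).1, fun p _ hm _ => (hbad p (hmult p hm)).1,
    fun hpos => absurd hΔ (not_lt.mpr hpos.le), fun p _ hm _ => (hbad p (hmult p hm)).2⟩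

/-- Primes of an odd Heegner discriminant are odd and prime to `Δ_min(W)`. [cite: GrossLMS1991, §1 (p. 235)] -/
theorem prime_dvd_discr_facts (hK : IsImaginaryQuadratic K) (hodd : Odd (discr K))
    (hH : SatisfiesHeegnerHypothesis (W.conductorNorm ℤ) K) {p : ℕ} (hp : p.Prime) (hpd : (p : ℤ) ∣ discr K) :
    p ≠ 2 ∧ ¬ (p : ℤ) ∣ minimalDiscriminantInt W := by
  have hp2 : p ≠ 2 := by
    rintro rfl
    exact (Int.not_even_iff_odd.mpr hodd) (even_iff_two_dvd.mpr (by exact_mod_cast hpd))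
  exact ⟨hp2, fun hpΔ => Literature.SatisfiesHeegnerHypothesis.not_dvd_discr hK.1 hH hp
    (dvd_conductorNorm_of_dvd_minimalDiscriminantInt W hp hpΔ) hpd⟩

/-! ## §2. General DEF = 1 on `Δ < 0`: one transposition prime, the rest silent -/

/-- **DEF = 1 twins on `Δ < 0`, composite `d_K` allowed** (mod `MazurRubin2010.prop33_rat`): `K` imaginary quadratic, `d_K` odd,
Heegner for `N_W`, `2` split; `q₀ ∣ d_K` a prime at which `ψ` has exactly one root, and `ψ` has no root at every other prime of
`d_K` (DEF(W,K) = 1). Then for any elliptic model `Wd ≅ W^{(d_K)}`: `#Sel₂(Wd) ∣ 2·#Sel₂(W)`, `#Sel₂(W) ∣ 2·#Sel₂(Wd)`, and the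
product is not a square. [cite: MazurRubin2010, Prop. 3.3 and Cor. 3.4 (i)] -/
theorem selmer_twin_DEF_one (h33 : MazurRubin2010.prop33_rat) (hΔ : W.Δ < 0) (hK : IsImaginaryQuadratic K)
    (hodd : Odd (discr K)) (hH : SatisfiesHeegnerHypothesis (W.conductorNorm ℤ) K)
    (h2K : ((Ideal.span {(2 : ℤ)}).primesOver (𝓞 K)).ncard = 2) {q₀ : ℕ} (hq₀ : q₀.Prime) (hq₀d : (q₀ : ℤ) ∣ discr K)
    (huniq : ∃! x : ZMod q₀, 4 * x ^ 3 + ((integralModelInt W).b₂ : ZMod q₀) * x ^ 2 +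
      2 * ((integralModelInt W).b₄ : ZMod q₀) * x + ((integralModelInt W).b₆ : ZMod q₀) = 0)
    (hsil : ∀ p : ℕ, p.Prime → (p : ℤ) ∣ discr K → p ≠ q₀ → ∀ x : ZMod p, 4 * x ^ 3 +
      ((integralModelInt W).b₂ : ZMod p) * x ^ 2 + 2 * ((integralModelInt W).b₄ : ZMod p) * x +
        ((integralModelInt W).b₆ : ZMod p) ≠ 0)
    (Wd : WeierstrassCurve ℚ) [Wd.IsElliptic]
    (hWd : ∃ C : VariableChange ℚ, C • W.quadraticTwist (discr K : ℚ) = Wd) :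
    Nat.card (Wd.selmerGroup 2) ∣ 2 * Nat.card (W.selmerGroup 2) ∧
      Nat.card (W.selmerGroup 2) ∣ 2 * Nat.card (Wd.selmerGroup 2) ∧
      ¬ IsSquare (Nat.card (Wd.selmerGroup 2) * Nat.card (W.selmerGroup 2)) := by
  have h := prop33_twin_of_rootCount W h33 hΔ hK hodd hH h2K {q₀}
    (fun p hp => by
      rw [Finset.mem_singleton] at hp
      subst hp
      exact ⟨hq₀, hq₀d, huniq⟩)
    (fun p hp hpd hpT => hsil p hp hpd (fun h => hpT (Finset.mem_singleton.mpr h))) Wd hWd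
  rw [Finset.card_singleton, pow_one] at h
  exact ⟨h.1, h.2.1, fun hsq => Nat.not_even_one (h.2.2.mpr hsq)⟩

/-- **`#Sel₂(W) = 1 ⟹ #Sel₂(Wd) = 2` for EVERY DEF = 1 admissible Heegner field on `Δ < 0` with `2` split**
(mod `MazurRubin2010.prop33_rat`). [cite: MazurRubin2010, Prop. 3.3 and Cor. 3.4 (i)] -/
theorem natCard_selmerGroup_twin_eq_two_of_DEF_one (h33 : MazurRubin2010.prop33_rat) (hΔ : W.Δ < 0)
    (hK : IsImaginaryQuadratic K) (hodd : Odd (discr K)) (hH : SatisfiesHeegnerHypothesis (W.conductorNorm ℤ) K)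
    (h2K : ((Ideal.span {(2 : ℤ)}).primesOver (𝓞 K)).ncard = 2) {q₀ : ℕ} (hq₀ : q₀.Prime) (hq₀d : (q₀ : ℤ) ∣ discr K)
    (huniq : ∃! x : ZMod q₀, 4 * x ^ 3 + ((integralModelInt W).b₂ : ZMod q₀) * x ^ 2 +
      2 * ((integralModelInt W).b₄ : ZMod q₀) * x + ((integralModelInt W).b₆ : ZMod q₀) = 0)
    (hsil : ∀ p : ℕ, p.Prime → (p : ℤ) ∣ discr K → p ≠ q₀ → ∀ x : ZMod p, 4 * x ^ 3 +
      ((integralModelInt W).b₂ : ZMod p) * x ^ 2 + 2 * ((integralModelInt W).b₄ : ZMod p) * x +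
        ((integralModelInt W).b₆ : ZMod p) ≠ 0)
    (Wd : WeierstrassCurve ℚ) [Wd.IsElliptic]
    (hWd : ∃ C : VariableChange ℚ, C • W.quadraticTwist (discr K : ℚ) = Wd)
    (h1 : Nat.card (W.selmerGroup 2) = 1) : Nat.card (Wd.selmerGroup 2) = 2 := by
  obtain ⟨hdvd, -, hnsq⟩ := selmer_twin_DEF_one W h33 hΔ hK hodd hH h2K hq₀ hq₀d huniq hsil Wd hWd
  rw [h1, mul_one] at hdvd hnsq
  have hle : Nat.card (Wd.selmerGroup 2) ≤ 2 := Nat.le_of_dvd two_pos hdvd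
  interval_cases h : Nat.card (Wd.selmerGroup 2)
  · exact absurd ⟨0, rfl⟩ hnsq
  · exact absurd ⟨1, rfl⟩ hnsq
  · rfl

/-- **`#Sel₂(Wd) = 2 ⟹ #Sel₂(W) ∈ {1, 4}` for every DEF = 1 admissible Heegner field on `Δ < 0` with `2` split**
(mod `MazurRubin2010.prop33_rat`): the Selmer reach of «DEF = 1 ∧ Sel₂-minimal twin» is `#Sel₂(E) ≤ 4` in general, not only for
prime `d_K`. [cite: MazurRubin2010, Prop. 3.3 and Cor. 3.4 (i)] -/
theorem natCard_selmerGroup_eq_one_or_four_of_DEF_one (h33 : MazurRubin2010.prop33_rat) (hΔ : W.Δ < 0)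
    (hK : IsImaginaryQuadratic K) (hodd : Odd (discr K)) (hH : SatisfiesHeegnerHypothesis (W.conductorNorm ℤ) K)
    (h2K : ((Ideal.span {(2 : ℤ)}).primesOver (𝓞 K)).ncard = 2) {q₀ : ℕ} (hq₀ : q₀.Prime) (hq₀d : (q₀ : ℤ) ∣ discr K)
    (huniq : ∃! x : ZMod q₀, 4 * x ^ 3 + ((integralModelInt W).b₂ : ZMod q₀) * x ^ 2 +
      2 * ((integralModelInt W).b₄ : ZMod q₀) * x + ((integralModelInt W).b₆ : ZMod q₀) = 0)
    (hsil : ∀ p : ℕ, p.Prime → (p : ℤ) ∣ discr K → p ≠ q₀ → ∀ x : ZMod p, 4 * x ^ 3 +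
      ((integralModelInt W).b₂ : ZMod p) * x ^ 2 + 2 * ((integralModelInt W).b₄ : ZMod p) * x +
        ((integralModelInt W).b₆ : ZMod p) ≠ 0)
    (Wd : WeierstrassCurve ℚ) [Wd.IsElliptic]
    (hWd : ∃ C : VariableChange ℚ, C • W.quadraticTwist (discr K : ℚ) = Wd)
    (h2 : Nat.card (Wd.selmerGroup 2) = 2) : Nat.card (W.selmerGroup 2) = 1 ∨ Nat.card (W.selmerGroup 2) = 4 := by
  obtain ⟨-, hdvd, hnsq⟩ := selmer_twin_DEF_one W h33 hΔ hK hodd hH h2K hq₀ hq₀d huniq hsil Wd hWd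
  rw [h2] at hdvd hnsq
  have hle : Nat.card (W.selmerGroup 2) ≤ 4 := Nat.le_of_dvd (by norm_num) hdvd
  interval_cases h : Nat.card (W.selmerGroup 2)
  · exact absurd ⟨0, rfl⟩ hnsq
  · exact Or.inl rfl
  · exact absurd ⟨2, rfl⟩ hnsq
  · exact absurd hdvd (by decide)
  · exact Or.inr rfl

/-! ## §3. The `V_T` dichotomy at the prime of a prime Heegner field (Cor. 3.4 (i)) -/

/-- **Mazur–Rubin Cor. 3.4 (i) at the prime `ℓ` of a prime Heegner field, `Δ < 0`, `2` split** (mod the named fact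
`MazurRubin2010.cor34i_singleton_rat`, hypothesis `h34`): for every elliptic model `Wd ≅ W^{(−ℓ)}`,
`Sel₂(W)` STRICT at `ℓ` (`Sel₂(W) ≤ ker loc_ℓ`, the tree's `MazurRubin2010.strictLocalKer W ℚ_[ℓ] 2`) ⟹ `#Sel₂(Wd) = 2·#Sel₂(W)`,
and NOT strict ⟹ `#Sel₂(W) = 2·#Sel₂(Wd)`. (`T = {ℓ}`: `#E(ℚ_ℓ)[2] = 2` by §1 of `…PrimeHeegnerTwin`; no other prime ramifies.)
[cite: MazurRubin2010, Cor. 3.4 (i) with Def. 3.1 and Lemma 2.2 (i)] -/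
theorem cor34i_twin_prime_heegner (h34 : MazurRubin2010.cor34i_singleton_rat) (hΔ : W.Δ < 0) (hK : IsImaginaryQuadratic K)
    (hodd : Odd (discr K)) (hH : SatisfiesHeegnerHypothesis (W.conductorNorm ℤ) K)
    (h2K : ((Ideal.span {(2 : ℤ)}).primesOver (𝓞 K)).ncard = 2) {ℓ : ℕ} [Fact ℓ.Prime] (hd : discr K = -(ℓ : ℤ))
    (Wd : WeierstrassCurve ℚ) [Wd.IsElliptic]
    (hWd : ∃ C : VariableChange ℚ, C • W.quadraticTwist (discr K : ℚ) = Wd) :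
    (W.selmerGroup 2 ≤ MazurRubin2010.strictLocalKer W ℚ_[ℓ] 2 →
        Nat.card (Wd.selmerGroup 2) = 2 * Nat.card (W.selmerGroup 2)) ∧
      (¬ W.selmerGroup 2 ≤ MazurRubin2010.strictLocalKer W ℚ_[ℓ] 2 →
        Nat.card (W.selmerGroup 2) = 2 * Nat.card (Wd.selmerGroup 2)) := by
  have hℓ : ℓ.Prime := Fact.out
  obtain ⟨hsqf, hd1⟩ := discr_squarefree_of_odd hK hodd
  obtain ⟨hS1, hS2, hS4, hS5⟩ := mr_splitting_list W hΔ hK.1 hH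
  have hℓd : (ℓ : ℤ) ∣ discr K := ⟨-1, by rw [hd]; ring⟩
  obtain ⟨C, hC⟩ := hWd
  have hWd' : ∃ C' : VariableChange ℚ, C' • Wd = W.quadraticTwist ((discr K : ℤ) : ℚ) :=
    ⟨C⁻¹, by rw [← hC, inv_smul_smul]⟩
  refine h34 W (discr K) hsqf hd1 K hK.1 (exists_sq_eq_discr hK.1) hS1 hS2 h2K hS4 hS5 ℓ hℓd
    (natCard_twoTorsion_padic_eq_two_of_discr_eq_neg_prime W hK hodd hH hd hΔ) (fun p _ hpd hpℓ => ?_) Wd hWd'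
  exfalso
  refine hpℓ ?_
  have h1 : (p : ℤ) ∣ (ℓ : ℤ) := by rw [hd] at hpd; exact dvd_neg.mp hpd
  exact (Nat.prime_dvd_prime_iff_eq Fact.out hℓ).mp (by exact_mod_cast h1)

/-- **On `#Sel₂(W) = 1` the prime Heegner twin is Sel₂-minimal, by Cor. 3.4 (i) as well** (mod `cor34i_singleton_rat`): the
trivial Selmer group is strict at every place, so the rank goes UP by one: `#Sel₂(Wd) = 2`.
[cite: MazurRubin2010, Cor. 3.4 (i)] -/
theorem natCard_selmerGroup_twin_eq_two_of_cor34i (h34 : MazurRubin2010.cor34i_singleton_rat) (hΔ : W.Δ < 0)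
    (hK : IsImaginaryQuadratic K) (hodd : Odd (discr K)) (hH : SatisfiesHeegnerHypothesis (W.conductorNorm ℤ) K)
    (h2K : ((Ideal.span {(2 : ℤ)}).primesOver (𝓞 K)).ncard = 2) {ℓ : ℕ} [Fact ℓ.Prime] (hd : discr K = -(ℓ : ℤ))
    (Wd : WeierstrassCurve ℚ) [Wd.IsElliptic]
    (hWd : ∃ C : VariableChange ℚ, C • W.quadraticTwist (discr K : ℚ) = Wd)
    (h1 : Nat.card (W.selmerGroup 2) = 1) : Nat.card (Wd.selmerGroup 2) = 2 := by
  have hbot : W.selmerGroup 2 = ⊥ := AddSubgroup.eq_bot_of_card_eq (W.selmerGroup 2) h1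
  have h := (cor34i_twin_prime_heegner W h34 hΔ hK hodd hH h2K hd Wd hWd).1 (by rw [hbot]; exact bot_le)
  rw [h1, mul_one] at h
  exact h

/-- **On the `#Sel₂(W) = 4` cells (`Ш(E)[2] ≅ (ℤ/2)²` on the habitat) the prime Heegner twin is Sel₂-minimal iff `Sel₂(W)`
is NOT strict at `ℓ`** (mod `cor34i_singleton_rat`): the DEF = 1 supply of a minimal twin on these cells is a Čebotarev
condition on the prime `ℓ` (some Selmer class locally non-trivial at `ℓ`) — Mazur–Rubin's twisting mechanism.
[cite: MazurRubin2010, Cor. 3.4 (i)] -/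
theorem natCard_selmerGroup_twin_eq_two_iff_not_strict (h34 : MazurRubin2010.cor34i_singleton_rat) (hΔ : W.Δ < 0)
    (hK : IsImaginaryQuadratic K) (hodd : Odd (discr K)) (hH : SatisfiesHeegnerHypothesis (W.conductorNorm ℤ) K)
    (h2K : ((Ideal.span {(2 : ℤ)}).primesOver (𝓞 K)).ncard = 2) {ℓ : ℕ} [Fact ℓ.Prime] (hd : discr K = -(ℓ : ℤ))
    (Wd : WeierstrassCurve ℚ) [Wd.IsElliptic]
    (hWd : ∃ C : VariableChange ℚ, C • W.quadraticTwist (discr K : ℚ) = Wd)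
    (h4 : Nat.card (W.selmerGroup 2) = 4) :
    Nat.card (Wd.selmerGroup 2) = 2 ↔ ¬ W.selmerGroup 2 ≤ MazurRubin2010.strictLocalKer W ℚ_[ℓ] 2 := by
  obtain ⟨hstrict, hnot⟩ := cor34i_twin_prime_heegner W h34 hΔ hK hodd hH h2K hd Wd hWd
  constructor
  · intro h2 hle
    have h := hstrict hle
    rw [h2, h4] at h
    norm_num at h
  · intro hn
    have h := hnot hn
    rw [h4] at h
    omega

end Summit.BirchSwinnertonDyer.BirchSwinnertonDyer.Theorems.GenusKolyTwin
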